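import Summits.CriticalPhenomena.Ising3DConformalLimit.Theorems.ArmDressingArmDressingGlueOfCrossLawPositive
import Summits.CriticalPhenomena.Ising3DConformalLimit.Theorems.ArmDressingArmDressingGlueSecondMoment
import Summits.CriticalPhenomena.Ising3DConformalLimit.Theorems.ArmDressingArmDressingGlueAxisTwoPoint
import Summits.CriticalPhenomena.Ising3DConformalLimit.Theorems.ArmDressingArmDressingGlueArmDoubling
import Summits.CriticalPhenomena.Ising3DConformalLimit.Theorems.ArmDressingArmDressingGlueBoxTwoPointSums
import Summits.CriticalPhenomena.Ising3DConformalLimit.Theorems.ArmDressingArmDressingGlueTwoBallPositive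
import Summits.CriticalPhenomena.Ising3DConformalLimit.Theorems.ArmDressingArmDressingGlueFkgReduction
import HarnessLib

/-!
# Route `ArmDressing`: the crux `ArmDressingGlue` (stmt-CriticalPhenomena-15700) PROVED

`ArmDressing.ArmDressingGlue = BallConnectivityMoebius → EvenPatternDecoupling → ArmExtensionFactorisation →
OneArmRenormalisedLimit` — the covariance bookkeeping of Camia–Feng (arXiv:2411.01467) §3.2.2–3.2.3 transposed to
`ℝ³` plus the infinite-volume Edwards–Sokal identity.  This file is the sorry-free end of the line `registered`
(skeleton v3, `Cruxes/ArmDressingGlue/Lines/birth.lean`): every registered stub has landed under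
`Theorems/ArmDressingArmDressingGlue*.lean`, and the two storeys compose as follows.

1. **Non-degeneracy of the CROSS law from B ∧ C** (`armDressing_crossLawPositive_of`): the statement
   `Vocab.CrossLawPositive` (positivity, as the mesh `δ → 0⁺`, of the infinite-volume critical FK-Ising probability
   that `n` pairs of discretised generalised balls are pairwise connected) — which the first lead had isolated as the
   one input of the transposed bookkeeping absent from A/B/C/ES as typed — is DERIVED from cruxes B and C by a
   second-moment method in one-arm units: Cauchy–Schwarz for the pair count with the 4-point connection inside the
   Ising 4-point function (Edwards–Sokal) and Lebowitz' inequality (`CrossPos.stub_secondMoment`); the dressed limit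
   of B ∧ C ∧ ES read on the axis, `⟨σ₀σ_{ke₁}⟩ ≍ a(k)²`, `a(k) = arm1(1/k,1)` (`CrossPos.stub_axisTwoPoint`); dyadic
   doubling of `a` from the one-arm ratio `a(κK)/a(K) → κ^{-Δ}`, `Δ ≤ 1` (`CrossPos.stub_armDoubling`); the
   Messager–Miracle-Solé comparison turning these into `Σ_{Λ_M}⟨σ₀σ_y⟩ ≤ C'M³a(M)²`, `⟨σ₀σ_y⟩ ≥ c'a(M)²` on `Λ_M`
   (`CrossPos.stub_boxTwoPointSums`); the resulting two-ball positivity (`CrossPos.stub_twoBallPositive`); and the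
   FKG reduction of `n` pairs of generalised balls to one pair of disjoint closed balls (`CrossPos.stub_fkgReduction`).
2. **The bookkeeping** (`InvBook.armDressingGlue_of_crossLawPositive`, previous lead): ES from its clauses, dressed
   existence, automatic translations/dilations (`Δ ∈ [1/2,1]`)/rotations of the normalised limit, and dressed
   inversion covariance from `CrossLawPositive` (Camia–Feng §3.2.3 transposed).

References: F. Camia, Y. Feng, arXiv:2411.01467 (SPA 2025), Thm 1, Lemmas 12–17, §3.2.2–3.2.3; J. L. Lebowitz,
Comm. Math. Phys. 35 (1974); A. Messager, S. Miracle-Solé, J. Stat. Phys. 17 (1977); C. M. Fortuin,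
P. W. Kasteleyn, J. Ginibre, Comm. Math. Phys. 22 (1971); G. Grimmett, *The Random-Cluster Model* (2006), Thm 4.19.
-/

noncomputable section

namespace Summit.CriticalPhenomena.Ising3DConformalLimit.Theorems

open Summit.CriticalPhenomena.Ising3DConformalLimit.Theses
open Summit.CriticalPhenomena.Ising3DConformalLimit.Cruxes.ArmDressingGlue

/-- **`CrossLawPositive` from cruxes B and C** (storey 1 of the line `registered`, v3): thread the axis two-point
asymptotics and the doubling of the one-arm probability through the box sums, the second-moment inequality and the
FKG reduction. [cite: CamiaFeng2025, §3.2.2] -/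
theorem armDressing_crossLawPositive_of (hB : ArmDressing.EvenPatternDecoupling)
    (hC : ArmDressing.ArmExtensionFactorisation) : Vocab.CrossLawPositive := by
  obtain ⟨c, C, k₀, hc, hax⟩ := CrossPos.stub_axisTwoPoint hB hC
  obtain ⟨⟨lam, K₀, hlam, hlam8, hK₀, hdbl⟩, hanti, hpos⟩ := CrossPos.stub_armDoubling hB hC
  exact CrossPos.stub_fkgReduction (CrossPos.stub_twoBallPositive CrossPos.stub_secondMoment
    ⟨⟨lam, K₀, hlam, hlam8, hK₀, hdbl⟩, hanti, hpos⟩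
    (CrossPos.stub_boxTwoPointSums c C k₀ hc hax lam K₀ hlam hlam8 hK₀ hdbl hanti hpos))

/-- **The crux `ArmDressing.ArmDressingGlue`** (item stmt-CriticalPhenomena-15700):
`BallConnectivityMoebius → EvenPatternDecoupling → ArmExtensionFactorisation → OneArmRenormalisedLimit`, by the
landed bookkeeping `InvBook.armDressingGlue_of_crossLawPositive` applied to `CrossLawPositive`, itself derived from
B and C. [cite: CamiaFeng2025, Thm 1 and §3.2.2–3.2.3] -/
theorem armDressing_armDressingGlue_proof : ArmDressing.ArmDressingGlue := fun hA hB hC =>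
  InvBook.armDressingGlue_of_crossLawPositive (armDressing_crossLawPositive_of hB hC) hA hB hC

end Summit.CriticalPhenomena.Ising3DConformalLimit.Theorems

end
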